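import Summits.Parity.GeneralizedHardyLittlewood.Theorems.LiouvilleShiftedTablesEngineToPairsSieveCaseTwo

/-!
# Correlation sieve for line `Sketch` of the crux `EngineToPairs` (stmt-Parity-14659), part 7b:
# the flat split of a tuple with two high smooth factors and a tiny rough part

Support file for the stub `stub_sieve : CorrelationSieveFamily`, continuing part 7a.  Situation (case (B1)
of a two-high-factor tuple): the product is `α ⋆ σ ⋆ τ` where `α` (the rough part) lives on `r ≤ R`,
`R = 16 x^{3δ/5}`, with `|α| ≤ log x · σ₀^4`; `σ` is the boxed high smooth factor `s` (`1` or `log` on the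
integers of `(max(⌊lo⌋,⌊V⌋), ⌊2lo⌋]`, `lo ≥ 1`, `2 lo ≤ x`, `V < 2 lo`); `τ = 1_{(V,∞)}` is the unboxed high
`ζ` factor, `V = x^{9/20}`.  `flat_split_bound`: splitting at `2 lo · R ≤ x^{1/2−2δ}` (Type I, modulus
`α ⋆ σ`, free `τ`), `lo ≥ 16 x^{1/2+2δ}` (Type I, modulus `α ⋆ τ` truncated, free `σ`), and otherwise
Type I₂ (`typeI2_dispatch_*`), the family sum is `≤ 4 (log x)² (TI + TI2)`.
-/

noncomputable section

namespace Summit.Parity.GeneralizedHardyLittlewood.Theorems.EngineToPairs.Sieve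

open Finset Real
open scoped ArithmeticFunction.sigma
open Literature.NumberTheory.Sieve Literature.NumberTheory.Sieve.BFI

/-- `σ₀(m)^k ≤ tauPow 6 m` for `1 ≤ k ≤ 6`. [folklore] -/
theorem sigma_pow_le_tauPow_six {k : ℕ} (hk1 : 1 ≤ k) (hk : k ≤ 6) (m : ℕ) :
    ((σ 0 m : ℕ) : ℝ) ^ k ≤ tauPow 6 m := by
  rw [sigma_zero_pow_eq_tauPow]; exact tauPow_le_tauPow hk hk1 m

set_option maxHeartbeats 1600000 in
/-- **The flat split** (see the module docstring). `c` is the coefficient of the flat factor: constant `1`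
(`hc = Or.inl`) or `log` (`hc = Or.inr`). [this line] -/
theorem flat_split_bound {δ x : ℝ} (hLx : Large δ x) (hδ : 0 < δ) (hδ' : δ ≤ 1 / 100)
    {Qs : Finset ℕ} {w : ℕ → ℕ → ℝ} {TI TI2 : ℝ} (hTI : 0 ≤ TI) (hTI2 : 0 ≤ TI2)
    (hfamI : TypeIFam Qs w x (1 / 2 - 2 * δ) 6 TI) (hfamI2 : TypeI2Fam Qs w x δ (3 * δ) 6 TI2)
    (α σf τf : ArithmeticFunction ℝ)
    (hαR : ∀ r, α r ≠ 0 → (r : ℝ) ≤ 16 * x ^ (3 * δ / 5))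
    (hαb : ∀ r, |α r| ≤ Real.log x * ((σ 0 r : ℕ) : ℝ) ^ 4)
    {lo : ℝ} (hlo1 : 1 ≤ lo) (hlox : 2 * lo ≤ x) (hVlo : x ^ ((9 : ℝ) / 20) < 2 * lo)
    (c : ℕ → ℝ) (hc : c = (fun _ => (1 : ℝ)) ∨ c = fun n : ℕ => Real.log (n : ℝ))
    (hσ : ∀ n, σf n = if max ⌊lo⌋₊ ⌊x ^ ((9 : ℝ) / 20)⌋₊ + 1 ≤ n ∧ n ≤ ⌊2 * lo⌋₊ then c n else 0)
    (hτ : ∀ n, τf n = if x ^ ((9 : ℝ) / 20) < (n : ℝ) then 1 else 0) :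
    ∑ q ∈ Qs, |∑ n ∈ Ioc ⌊x / 2⌋₊ ⌊x⌋₊, (α * σf * τf) n * w q n| ≤ 4 * Real.log x ^ 2 * (TI + TI2) := by
  classical
  have hx1 : 1 ≤ x := hLx.one_lt.le
  have hx0 : 0 < x := hLx.pos
  have hxlt : 1 < x := hLx.one_lt
  have hlog1 : 1 ≤ Real.log x := hLx.one_le_log
  have hlog0 : 0 < Real.log x := hLx.log_pos
  have hsq0 : 0 ≤ Real.log x ^ 2 := sq_nonneg _
  set V : ℝ := x ^ ((9 : ℝ) / 20) with hV
  have hV0 : 0 ≤ V := Real.rpow_nonneg hx0.le _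
  set R : ℝ := 16 * x ^ (3 * δ / 5) with hR
  have hxδ0 : 0 ≤ x ^ (3 * δ / 5) := Real.rpow_nonneg hx0.le _
  have hR16 : (16 : ℝ) ≤ R := by
    have : 1 ≤ x ^ (3 * δ / 5) := Real.one_le_rpow hx1 (by positivity)
    rw [hR]; linarith
  have hR1 : 1 ≤ R := by linarith
  have hR0 : 0 < R := by linarith
  have hRδ : R ≤ x ^ δ := by
    calc R ≤ 512 * x ^ (3 * δ / 5) := by rw [hR]; nlinarith
      _ ≤ x ^ (3 * δ / 5 + 2 * δ / 5) := hLx.fivetwelve_mul_rpow_le _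
      _ = x ^ δ := by ring_nf
  have hRx : R ≤ x := hRδ.trans (by
    calc x ^ δ ≤ x ^ (1 : ℝ) := Real.rpow_le_rpow_of_exponent_le hx1 (by linarith)
      _ = x := Real.rpow_one x)
  -- the target inequalities
  have hb1 : Real.log x * Real.log x * TI ≤ 4 * Real.log x ^ 2 * (TI + TI2) := by
    have e : 4 * Real.log x ^ 2 * (TI + TI2) - Real.log x * Real.log x * TI = Real.log x ^ 2 * (3 * TI + 4 * TI2) := by ring
    have h2 : 0 ≤ Real.log x ^ 2 * (3 * TI + 4 * TI2) := mul_nonneg hsq0 (by linarith)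
    linarith
  have hb2 : 2 * Real.log x * Real.log x * TI ≤ 4 * Real.log x ^ 2 * (TI + TI2) := by
    have e : 4 * Real.log x ^ 2 * (TI + TI2) - 2 * Real.log x * Real.log x * TI = Real.log x ^ 2 * (2 * TI + 4 * TI2) := by ring
    have h2 : 0 ≤ Real.log x ^ 2 * (2 * TI + 4 * TI2) := mul_nonneg hsq0 (by linarith)
    linarith
  have hb3 : 4 * Real.log x * Real.log x * TI2 ≤ 4 * Real.log x ^ 2 * (TI + TI2) := by
    have e : 4 * Real.log x ^ 2 * (TI + TI2) - 4 * Real.log x * Real.log x * TI2 = Real.log x ^ 2 * (4 * TI) := by ring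
    have h2 : 0 ≤ Real.log x ^ 2 * (4 * TI) := mul_nonneg hsq0 (by linarith)
    linarith
  have hb4 : 2 * Real.log x * TI2 ≤ 4 * Real.log x ^ 2 * (TI + TI2) := by
    have e : 4 * Real.log x ^ 2 * (TI + TI2) - 2 * Real.log x * TI2 =
        Real.log x * ((2 * Real.log x - 2) * TI2) + Real.log x ^ 2 * (4 * TI + 2 * TI2) := by ring
    have h1 : 0 ≤ Real.log x * ((2 * Real.log x - 2) * TI2) := mul_nonneg hlog0.le (mul_nonneg (by linarith) hTI2)
    have h2 : 0 ≤ Real.log x ^ 2 * (4 * TI + 2 * TI2) := mul_nonneg hsq0 (by linarith)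
    linarith
  -- pointwise facts on `σ`, `τ`, `α`
  have hlo0 : 0 < lo := by linarith
  have hσsupp : ∀ n, σf n ≠ 0 → lo < n ∧ (n : ℝ) ≤ 2 * lo := by
    intro n hn
    rw [hσ n] at hn
    by_cases h : max ⌊lo⌋₊ ⌊V⌋₊ + 1 ≤ n ∧ n ≤ ⌊2 * lo⌋₊
    · refine ⟨(Nat.floor_lt hlo0.le).1 (by have := le_max_left ⌊lo⌋₊ ⌊V⌋₊; omega), ?_⟩
      exact (Nat.le_floor_iff (by linarith)).1 h.2
    · exact absurd (if_neg h) hn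
  have hcb : ∀ n : ℕ, (n : ℝ) ≤ x → |c n| ≤ Real.log x := by
    intro n hn
    rcases hc with hc | hc <;> rw [hc]
    · simp only [abs_one]; exact hlog1
    · simp only
      rw [abs_of_nonneg (Real.log_natCast_nonneg n)]
      rcases Nat.eq_zero_or_pos n with rfl | hn0
      · simp [hlog0.le]
      · exact Real.log_le_log (by exact_mod_cast hn0) hn
  have hσb : ∀ n, |σf n| ≤ Real.log x * ((σ 0 n : ℕ) : ℝ) ^ 0 := by
    intro n
    rw [pow_zero, mul_one]
    by_cases h0 : σf n = 0
    · rw [h0, abs_zero]; exact hlog0.le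
    · have hn := (hσsupp n h0).2
      rw [hσ n] at h0 ⊢
      split_ifs with h
      · exact hcb n (hn.trans hlox)
      · exact absurd (if_neg h) (by rwa [if_neg h] at h0)
  have hτb : ∀ n, |τf n| ≤ 1 * ((σ 0 n : ℕ) : ℝ) ^ 0 := by
    intro n; rw [hτ n, pow_zero, mul_one]; split_ifs <;> simp
  have hαb6 : ∀ r, |α r| ≤ Real.log x * tauPow 6 r := by
    intro r
    rcases Nat.eq_zero_or_pos r with rfl | hr
    · simp only [ArithmeticFunction.map_zero, abs_zero]; exact mul_nonneg hlog0.le (tauPow_nonneg 6 0)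
    · exact (hαb r).trans (mul_le_mul_of_nonneg_left (sigma_pow_le_tauPow_six (by norm_num) (by norm_num) r) hlog0.le)
  have hαRle : ∀ r, α r ≠ 0 → (r : ℝ) ≤ R := hαR
  have hγ1 : 1 / 2 - 2 * δ ≤ (1 : ℝ) := by linarith
  -- the interval data of `σ`
  set Sa : ℕ := max ⌊lo⌋₊ ⌊V⌋₊ with hSa
  set Sb : ℕ := ⌊2 * lo⌋₊ with hSb
  have hSbx : (Sb : ℝ) ≤ x := (Nat.floor_le (by linarith)).trans hlox
  have hSblo : (Sb : ℝ) ≤ 2 * lo := Nat.floor_le (by linarith)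
  have ha1 : 1 ≤ Sa + 1 := by omega
  by_cases hcase1 : 2 * lo * R ≤ x ^ (1 / 2 - 2 * δ)
  · ------------------------------------------------------------ (i) Type I: modulus `α ⋆ σ`, free `τ`
    have hτind : ∀ n : ℕ, 1 ≤ n → (n : ℝ) ≤ x → τf n = indAF ⌊V⌋₊ ⌊x⌋₊ n := by
      intro n _ hnx
      rw [hτ n, indAF_apply]
      have hnx' : n ≤ ⌊x⌋₊ := Nat.le_floor hnx
      by_cases h : V < (n : ℝ)
      · rw [if_pos h, if_pos ⟨Nat.succ_le_of_lt ((Nat.floor_lt hV0).2 h), hnx'⟩]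
      · rw [if_neg h, if_neg]
        rintro ⟨h1, -⟩
        exact h ((Nat.floor_lt hV0).1 (Nat.lt_of_succ_le h1))
    have hloc : ∀ q, ∑ n ∈ Ioc ⌊x / 2⌋₊ ⌊x⌋₊, (α * σf * τf) n * w q n =
        ∑ n ∈ Ioc ⌊x / 2⌋₊ ⌊x⌋₊, (α * σf * indAF ⌊V⌋₊ ⌊x⌋₊) n * w q n := fun q =>
      sum_Ioc_mul_apply_congr_right (α * σf) τf (indAF ⌊V⌋₊ ⌊x⌋₊) (w q) hτind
    have hαsupp : ∀ m, (α * σf) m ≠ 0 → (m : ℝ) ≤ x ^ (1 / 2 - 2 * δ) := by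
      intro m hm
      obtain ⟨r, n, hrn, hr, hn⟩ := exists_pair_of_mul_apply_ne_zero hm
      rw [← hrn, Nat.cast_mul]
      calc (r : ℝ) * n ≤ R * (2 * lo) := mul_le_mul (hαRle r hr) (hσsupp n hn).2 (Nat.cast_nonneg n) hR0.le
        _ = 2 * lo * R := by ring
        _ ≤ x ^ (1 / 2 - 2 * δ) := hcase1
    have hαb' : ∀ m, |(α * σf) m| ≤ (Real.log x * Real.log x) * tauPow 6 m := by
      intro m
      have h := abs_mul_apply_le_sigma_zero_pow (F := α) (G := σf) (a := 4) (b := 0) hlog0.le hlog0.le hαb hσb m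
      rcases Nat.eq_zero_or_pos m with rfl | hm
      · simp only [ArithmeticFunction.map_zero, abs_zero]
        exact mul_nonneg (mul_nonneg hlog0.le hlog0.le) (tauPow_nonneg 6 0)
      · exact h.trans (mul_le_mul_of_nonneg_left (sigma_pow_le_tauPow_six (by norm_num) (by norm_num) m)
          (mul_nonneg hlog0.le hlog0.le))
    have hbound := typeI_dispatch_one hfamI hx1 hγ1 (α * σf) (indAF ⌊V⌋₊ ⌊x⌋₊) (by positivity) hαsupp hαb'
      (a := ⌊V⌋₊ + 1) (b := ⌊x⌋₊) (by omega) (fun n => indAF_apply _ _ n)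
    calc ∑ q ∈ Qs, |∑ n ∈ Ioc ⌊x / 2⌋₊ ⌊x⌋₊, (α * σf * τf) n * w q n|
        = ∑ q ∈ Qs, |∑ n ∈ Ioc ⌊x / 2⌋₊ ⌊x⌋₊, (α * σf * indAF ⌊V⌋₊ ⌊x⌋₊) n * w q n| :=
          Finset.sum_congr rfl fun q _ => by rw [hloc q]
      _ ≤ Real.log x * Real.log x * TI := hbound
      _ ≤ 4 * Real.log x ^ 2 * (TI + TI2) := hb1
  by_cases hcase2 : 16 * x ^ (1 / 2 + 2 * δ) ≤ lo
  · ------------------------------------------------------------ (ii) Type I: modulus `α ⋆ τ` truncated, free `σ`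
    set N₀ : ℕ := ⌊lo⌋₊ + 1 with hN₀
    have hN₀lo : lo < N₀ := by rw [hN₀]; push_cast; exact Nat.lt_floor_add_one lo
    have hβsupp : ∀ n, σf n ≠ 0 → N₀ ≤ n := fun n hn =>
      Nat.succ_le_of_lt ((Nat.floor_lt hlo0.le).2 (hσsupp n hn).1)
    have hreassoc : α * σf * τf = α * τf * σf := mul_right_comm α σf τf
    have htrunc : ∀ q, ∑ n ∈ Ioc ⌊x / 2⌋₊ ⌊x⌋₊, (α * σf * τf) n * w q n =
        ∑ n ∈ Ioc ⌊x / 2⌋₊ ⌊x⌋₊, (truncAt x N₀ (α * τf) * σf) n * w q n := fun q => by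
      rw [hreassoc]; exact sum_Ioc_mul_apply_truncate (α * τf) σf (w q) hx0.le hβsupp
    set α'' := truncAt x N₀ (α * τf) with hα''
    have hα''supp : ∀ m, α'' m ≠ 0 → (m : ℝ) ≤ x ^ (1 / 2 - 2 * δ) := by
      intro m hm
      have h1 : (m : ℝ) * N₀ ≤ x := le_of_truncAt_ne_zero hm
      have hN₀pos : (0 : ℝ) < N₀ := by linarith
      have h2 : (m : ℝ) ≤ x / N₀ := by rw [le_div_iff₀ hN₀pos]; exact h1
      have h3 : x / N₀ ≤ x / (16 * x ^ (1 / 2 + 2 * δ)) :=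
        div_le_div_of_nonneg_left hx0.le (by positivity) (hcase2.trans hN₀lo.le)
      have h4 : x / (16 * x ^ (1 / 2 + 2 * δ)) ≤ x ^ (1 / 2 - 2 * δ) := by
        rw [div_le_iff₀ (by positivity)]
        have e : x = x ^ (1 / 2 - 2 * δ) * x ^ (1 / 2 + 2 * δ) := by rw [← Real.rpow_add hx0]; norm_num
        have h0 : 0 ≤ x ^ (1 / 2 - 2 * δ) * x ^ (1 / 2 + 2 * δ) := by positivity
        nlinarith
      linarith
    have hατ : ∀ m, |(α * τf) m| ≤ Real.log x * tauPow 6 m := by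
      intro m
      have h := abs_mul_apply_le_sigma_zero_pow (F := α) (G := τf) (a := 4) (b := 0) hlog0.le zero_le_one hαb hτb m
      rcases Nat.eq_zero_or_pos m with rfl | hm
      · simp only [ArithmeticFunction.map_zero, abs_zero]; exact mul_nonneg hlog0.le (tauPow_nonneg 6 0)
      · rw [mul_one] at h
        exact h.trans (mul_le_mul_of_nonneg_left (sigma_pow_le_tauPow_six (by norm_num) (by norm_num) m) hlog0.le)
    have hα''b : ∀ m, |α'' m| ≤ Real.log x * tauPow 6 m := fun m => (abs_truncAt_le x N₀ _ m).trans (hατ m)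
    rcases hc with hc1 | hc2
    · -- flat factor has coefficient `1`
      have hβ : ∀ n, σf n = if Sa + 1 ≤ n ∧ n ≤ Sb then 1 else 0 := fun n => by rw [hσ n, hc1]
      have hbound := typeI_dispatch_one hfamI hx1 hγ1 α'' σf hlog0 hα''supp hα''b ha1 hβ
      calc ∑ q ∈ Qs, |∑ n ∈ Ioc ⌊x / 2⌋₊ ⌊x⌋₊, (α * σf * τf) n * w q n|
          = ∑ q ∈ Qs, |∑ n ∈ Ioc ⌊x / 2⌋₊ ⌊x⌋₊, (α'' * σf) n * w q n| :=
            Finset.sum_congr rfl fun q _ => by rw [htrunc q]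
        _ ≤ Real.log x * TI := hbound
        _ ≤ 4 * Real.log x ^ 2 * (TI + TI2) := by
            have : Real.log x * TI ≤ Real.log x * Real.log x * TI := by
              have : 0 ≤ Real.log x * (Real.log x - 1) * TI := by
                apply mul_nonneg (mul_nonneg hlog0.le (by linarith)) hTI
              nlinarith
            exact this.trans hb1
    · -- flat factor has coefficient `log`
      have hβ : ∀ n, σf n = if Sa + 1 ≤ n ∧ n ≤ Sb then Real.log n else 0 := fun n => by rw [hσ n, hc2]
      have hbound := typeI_dispatch_log hfamI hx1 hγ1 α'' σf hlog0 hα''supp hα''b ha1 hSbx hβ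
      calc ∑ q ∈ Qs, |∑ n ∈ Ioc ⌊x / 2⌋₊ ⌊x⌋₊, (α * σf * τf) n * w q n|
          = ∑ q ∈ Qs, |∑ n ∈ Ioc ⌊x / 2⌋₊ ⌊x⌋₊, (α'' * σf) n * w q n| :=
            Finset.sum_congr rfl fun q _ => by rw [htrunc q]
        _ ≤ 2 * Real.log x * Real.log x * TI := hbound
        _ ≤ 4 * Real.log x ^ 2 * (TI + TI2) := hb2
  · ------------------------------------------------------------ (iii) Type I₂
    push Not at hcase1 hcase2
    have hSab : Sa ≤ Sb := by
      rw [hSa, hSb]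
      refine max_le (Nat.floor_mono (by linarith)) (Nat.floor_mono hVlo.le)
    have hSbR : (Sb : ℝ) * R ≤ x ^ (1 / 2 + 3 * δ) := by
      have h1 : (Sb : ℝ) * R ≤ (32 * x ^ (1 / 2 + 2 * δ)) * (16 * x ^ (3 * δ / 5)) := by
        refine mul_le_mul (hSblo.trans (by linarith)) le_rfl hR0.le (by positivity)
      have h2 : (32 * x ^ (1 / 2 + 2 * δ)) * (16 * x ^ (3 * δ / 5)) = 512 * x ^ (1 / 2 + 13 * δ / 5) := by
        have e : x ^ (1 / 2 + 2 * δ) * x ^ (3 * δ / 5) = x ^ (1 / 2 + 13 * δ / 5) := by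
          rw [← Real.rpow_add hx0]; congr 1; ring
        calc (32 * x ^ (1 / 2 + 2 * δ)) * (16 * x ^ (3 * δ / 5)) = 512 * (x ^ (1 / 2 + 2 * δ) * x ^ (3 * δ / 5)) := by ring
          _ = 512 * x ^ (1 / 2 + 13 * δ / 5) := by rw [e]
      calc (Sb : ℝ) * R ≤ 512 * x ^ (1 / 2 + 13 * δ / 5) := by rw [← h2]; exact h1
        _ ≤ x ^ (1 / 2 + 13 * δ / 5 + 2 * δ / 5) := hLx.fivetwelve_mul_rpow_le _
        _ = x ^ (1 / 2 + 3 * δ) := by ring_nf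
    have hvac : 2 * R * Sb * V ≤ x := by
      have h1 : 2 * R * Sb * V ≤ 2 * (16 * x ^ (3 * δ / 5)) * (32 * x ^ (1 / 2 + 2 * δ)) * V := by
        have hSb' : (Sb : ℝ) ≤ 32 * x ^ (1 / 2 + 2 * δ) := hSblo.trans (by linarith)
        have : 2 * R * Sb * V = (2 * R * V) * Sb := by ring
        rw [this]
        have : 2 * (16 * x ^ (3 * δ / 5)) * (32 * x ^ (1 / 2 + 2 * δ)) * V = (2 * R * V) * (32 * x ^ (1 / 2 + 2 * δ)) := by
          rw [hR]; ring
        rw [this]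
        exact mul_le_mul_of_nonneg_left hSb' (by positivity)
      have h2 : 2 * (16 * x ^ (3 * δ / 5)) * (32 * x ^ (1 / 2 + 2 * δ)) * V = 1024 * x ^ (19 / 20 + 13 * δ / 5) := by
        have e : x ^ (3 * δ / 5) * x ^ (1 / 2 + 2 * δ) * x ^ ((9 : ℝ) / 20) = x ^ (19 / 20 + 13 * δ / 5) := by
          rw [← Real.rpow_add hx0, ← Real.rpow_add hx0]; congr 1; ring
        calc 2 * (16 * x ^ (3 * δ / 5)) * (32 * x ^ (1 / 2 + 2 * δ)) * V
            = 1024 * (x ^ (3 * δ / 5) * x ^ (1 / 2 + 2 * δ) * x ^ ((9 : ℝ) / 20)) := by rw [hV]; ring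
          _ = 1024 * x ^ (19 / 20 + 13 * δ / 5) := by rw [e]
      calc 2 * R * Sb * V ≤ 1024 * x ^ (19 / 20 + 13 * δ / 5) := by rw [← h2]; exact h1
        _ ≤ x := hLx.vac_le
    have hσ' : ∀ n, σf n = if Sa < n ∧ n ≤ Sb then c n else 0 := by
      intro n; rw [hσ n]; simp only [Nat.add_one_le_iff]
    rcases hc with hc1 | hc2
    · have hσ1 : ∀ n, σf n = if Sa < n ∧ n ≤ Sb then 1 else 0 := fun n => by rw [hσ' n, hc1]
      have hbound := typeI2_dispatch_one hfamI2 hx1 α σf τf hlog0 hR1 hRδ hRx hαRle hαb6 hSab hSbR hSbx hσ1 hτ hvac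
      exact hbound.trans hb4
    · have hσ2 : ∀ n, σf n = if Sa < n ∧ n ≤ Sb then Real.log n else 0 := fun n => by rw [hσ' n, hc2]
      have hbound := typeI2_dispatch_log hfamI2 hx1 α σf τf hlog0 hR1 hRδ hRx hαRle hαb6 hSab hSbR hSbx hσ2 hτ hvac
      exact hbound.trans hb3

end Summit.Parity.GeneralizedHardyLittlewood.Theorems.EngineToPairs.Sieve

namespace Summit.Parity.GeneralizedHardyLittlewood.Theorems.EngineToPairs

/-- Registered sub-goal of `stub_sieve` carried by this part (landing mechanics): `σ₀^k ≤ tauPow 6` for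
`1 ≤ k ≤ 6`. [folklore] -/
theorem sieve_part7b_anchor : ∀ (k : ℕ), 1 ≤ k → k ≤ 6 → ∀ (m : ℕ), ((ArithmeticFunction.sigma 0 m : ℕ) : ℝ) ^ k ≤ tauPow 6 m :=
  fun _ hk1 hk m => Sieve.sigma_pow_le_tauPow_six hk1 hk m

end Summit.Parity.GeneralizedHardyLittlewood.Theorems.EngineToPairs

end
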